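import Summits.ResolutionOfSingularities.ResolutionOfSingularities.Theorems.BranchStrictTransform
import HarnessLib

/-!
# BranchResolution — decomp-res lens-4 g45 node «BranchResolution», FILE B (§164–§165): `HuggedBranchResolution` IS A THEOREM

STAGE 2 of door (R3-C) (critic ROW 244 / letters 236b–236c).  The located residual of the g44 root,
`HugValuationCut.HuggedBranchResolution` (Theorems/CurveBranchPort: along ANY lens-6 branch hugging an integral one-dimensional
germ, some followed germ is regular and one-dimensional), is DISCHARGED with ZERO binders — `huggedBranchResolution_holds` — by
the δ-DESCENT of Kollár Thm. 1.101 run ALONG THE BRANCH; hence ITEM 32207 `MaxContactCut.CurveLawAll` (`curveLawAll_holds`, the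
g44 port `curveLawAll_of_huggedBranchResolution` applied to the theorem).

§164 THE LOOP.  Invariant `Inv j` = «`𝔮_j := (strictIter B m H j)_{pt (m+j)}` is prime and `dim 𝒪_{m+j}/𝔮_j = 1`», carried
through a POINT round by (E1) + the one-step engine `curveChain_stage_step` BY NAME (with finiteness of the normalisation FREE:
the stage is locally of finite type over the field, `Branch.base`, so its stalks are G-rings, `curveChain_finite_base`) and through
a FOREIGN round by (E2) (`strictIter_inv_succ`, `strictIter_inv_all`); `δ_j := branchDelta 𝒪_{m+j} 𝔮_j ∈ ℕ`
(`strictIter_delta_ne_top`) is antitone (`strictIter_delta_le`) and DROPS at a point round unless `𝒪_{m+j}/𝔮_j` is regular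
(`regular_or_delta_lt`); a branch has a point round after every stage (`Branch.io`, `exists_point_round`); induction on a
δ-bound gives a regular followed germ (`exists_regular_strictIter`).  §165 the two credit objects.

NON-VACUITY (paper standard, letter 236c (u5)).  (i) A point round where δ DROPS: the cusp `Γ = V(y² − x³) ⊂ 𝔸²_k` hugged at
the origin `P`; `𝒪_{𝔸²,P}/𝔮 ≅ k[t², t³]_{(t²,t³)}` has normalisation `k[t]_{(t)}` and `δ₀ = dim_k k[t]/k[t²,t³] = 1`; blowing up
`P` (chart `y = x·y₁`: `x²(y₁² − x)`), the strict transform `Γ₁ = V(y₁² − x)` passes through the followed point `P₁ = (0,0)` of the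
exceptional line and is REGULAR there, `δ₁ = 0 < 1 = δ₀` — `regular_or_delta_lt` takes its right branch at round 0 and, at the
next point round through `P₁`, its left branch (`𝒪₁/𝔮₁` regular of dimension one), which is the `∃ j` of F with `j = 1`
(Kollár 2007, Ex. 1.102 / proof of Thm. 1.101; Hartshorne 1977, Ex. I.5.6, V.3.9.1).  (ii) A foreign round where δ is UNCHANGED:
same `Γ`, `P`, but the round blows up the (regular, closed) point `Q = (1,1) ≠ P` (`pt ∉ supp centre`, `Branch.kind` right
case): the stalk map at `P` is an isomorphism, `𝔮' ↤ 𝔮`, `𝒪/𝔮 ≃+* 𝒪'/𝔮'` (E2) and `δ' = δ = 1`; nothing improves, which is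
why `Branch.io` (a point round after every stage) is load-bearing in `exists_regular_strictIter`.  (iii) The guards of F are
sharp: a NON-PRIME hugged germ (`y² = 0`, hugged forever along the `x`-axis, never regular) and a prime of dimension `≠ 1`
(the maximal ideal: its strict transform is empty) are excluded by `IsPrime` / `ringKrullDim = 1` (probes P3, P4 of bc/Probe.lean).

HONEST SCOPE (u7).  The discharge uses NO hypothesis on the field `k` (no perfectness, characteristic or algebraic closure) and
no resolution input: `SatelliteExitClasses.Branch` carries exactly lens-6's fields — stages `St i` with a structure map to
`Spec k` satisfying `IsBase` (separated, locally of finite type, quasi-compact, REGULAR, `dim ≤ 4`), the followed closed points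
`pt`, regular centres `centre` blown up by `π i` (`isBlowup`), `pt_map`, `kind` (point round or foreign round) and `io`
(infinitely many point rounds).  In the g45 root (FILE C) only position 2 `hF` disappears; `hSL`, `hH`/`h71`, the ports, the
non-threefold mixed cells `hB hC4 hD4` ((R1) BARRIER tag unchanged) and the leaves `hNP hPu hR` are untouched.
No `def`, no named fact, no port, no sorry; std axioms.  [cite: Kollar2007, §1.4, Thm. 1.101] [cite: Matsumura1987, §32 p. 260]
-/

noncomputable section

set_option linter.dupNamespace false

open CategoryTheory CategoryTheory.Limits AlgebraicGeometry TopologicalSpace IsLocalRing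
open Literature.AlgebraicGeometry.Resolution Scheme.IdealSheafData
open Summit.ResolutionOfSingularities.ResolutionOfSingularities.Theorems
open WeakOrderReduction ForcedTowerClasses DivergentTowerClasses MonomialTowerClasses
open HugDimensionClasses HugDimensionKernels SurfaceShadowClasses SurfaceShadowKernels AbsoluteContactClasses

namespace Summit.ResolutionOfSingularities.ResolutionOfSingularities.Theorems.HugValuationCut

universe u

variable {k : Type} [Field k]

/-! ## §164 (g45 · E3, THE LOOP) δ-descent ALONG THE BRANCH.  For a branch `B` (lens-6's `SatelliteExitClasses.Branch`: point /
foreign rounds, infinitely many point rounds `Branch.io`), a stage `m` and an ideal sheaf `H` hugged from `m`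
(`∀ j, pt (m+j) ∈ supp (strictIter B m H j)`) whose followed stalk `𝔮₀ = H_{pt m}` is a PRIME with `dim 𝒪/𝔮₀ = 1`:
INVARIANT `Inv j` = «`𝔮_j := (strictIter B m H j)_{pt (m+j)}` is prime and `dim 𝒪_{m+j}/𝔮_j = 1`» for all `j`
(`strictIter_inv_all`; point rounds by (E1) + the g37 engine `curveChain_stage_step`, foreign rounds by (E2)); finiteness of
normalisation is free in every stage (G-ring, `Branch.base`); `δ_j := branchDelta 𝒪_{m+j} 𝔮_j ∈ ℕ` is antitone and drops at a
point round unless `𝒪_{m+j}/𝔮_j` is regular (`regular_or_delta_lt`); infinitely many point rounds ⇒ some followed germ is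
regular (`exists_regular_strictIter`, induction on a δ-bound). -/

section BranchLoop

/-- **finite normalisation is free along a branch**: every one-dimensional prime quotient `𝒪_{St i, x}/𝔮` of a stalk of a
branch stage has module-finite integral closure — the stage is locally of finite type over the field (`Branch.base`), so
its stalks are G-rings. [cite: Matsumura1987, §32 p. 260] -/
theorem module_finite_integralClosure_branch_stalk_quotient (B : SatelliteExitClasses.Branch k) (i : ℕ)
    (x : B.St i) (𝔮 : Ideal ((B.St i).presheaf.stalk x)) [𝔮.IsPrime]
    (hd : ringKrullDim ((B.St i).presheaf.stalk x ⧸ 𝔮) = 1) :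
    Module.Finite ((B.St i).presheaf.stalk x ⧸ 𝔮)
      (integralClosure ((B.St i).presheaf.stalk x ⧸ 𝔮) (FractionRing ((B.St i).presheaf.stalk x ⧸ 𝔮))) := by
  haveI : LocallyOfFiniteType (B.str i) := (B.base i).locallyOfFiniteType
  haveI : IsLocalRing ((B.St i).presheaf.stalk x ⧸ 𝔮) :=
    IsLocalRing.of_surjective' (Ideal.Quotient.mk 𝔮) Ideal.Quotient.mk_surjective
  exact module_finite_integralClosure_of_isGRing_of_ringKrullDim_eq_one _
    (isGRing_of_surjective (Ideal.Quotient.mk 𝔮) Ideal.Quotient.mk_surjective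
      (isGRing_stalk_of_locallyOfFiniteType (B.str i) x)) hd

variable (B : SatelliteExitClasses.Branch k) (m : ℕ) (H : (B.St m).IdealSheafData)

/-- **`Inv j ⟹ Inv (j+1)`, with the δ-comparison** (one round of the branch).  If the followed stalk
`𝔮_j = (strictIter B m H j)_{pt (m+j)}` is prime with `dim 𝒪_{m+j}/𝔮_j = 1` and `H` is hugged from `m`, then
`𝔮_{j+1}` is prime, `dim 𝒪_{m+j+1}/𝔮_{j+1} = 1`, `δ_{j+1} ≤ δ_j`, and at a POINT round `δ_{j+1} = δ_j` forces
`𝒪_{m+j}/𝔮_j` regular.  Point round: (E1) + the g37 engine `curveChain_stage_step` BY NAME (finite normalisation from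
`module_finite_integralClosure_branch_stalk_quotient`); foreign round: (E2), `δ`/`dim` transported along the `RingEquiv`.
[cite: Kollar2007, §1.4, Thm. 1.101] -/
theorem strictIter_inv_succ
    (hH : ∀ j, B.pt (m + j) ∈ ((SatelliteExitClasses.strictIter B m H j).support : Set (B.St (m + j)))) (j : ℕ)
    [hP : (stalkIdeal (SatelliteExitClasses.strictIter B m H j) (B.pt (m + j))).IsPrime]
    (hd : ringKrullDim ((B.St (m + j)).presheaf.stalk (B.pt (m + j)) ⧸
      stalkIdeal (SatelliteExitClasses.strictIter B m H j) (B.pt (m + j))) = 1) :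
    (stalkIdeal (SatelliteExitClasses.strictIter B m H (j + 1)) (B.pt (m + (j + 1)))).IsPrime ∧
      ringKrullDim ((B.St (m + (j + 1))).presheaf.stalk (B.pt (m + (j + 1))) ⧸
        stalkIdeal (SatelliteExitClasses.strictIter B m H (j + 1)) (B.pt (m + (j + 1)))) = 1 ∧
      branchDelta ((B.St (m + (j + 1))).presheaf.stalk (B.pt (m + (j + 1))))
          (stalkIdeal (SatelliteExitClasses.strictIter B m H (j + 1)) (B.pt (m + (j + 1)))) ≤
        branchDelta ((B.St (m + j)).presheaf.stalk (B.pt (m + j)))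
          (stalkIdeal (SatelliteExitClasses.strictIter B m H j) (B.pt (m + j))) ∧
      ((((B.centre (m + j)).support : Set (B.St (m + j))) = {B.pt (m + j)}) →
        branchDelta ((B.St (m + (j + 1))).presheaf.stalk (B.pt (m + (j + 1))))
            (stalkIdeal (SatelliteExitClasses.strictIter B m H (j + 1)) (B.pt (m + (j + 1)))) =
          branchDelta ((B.St (m + j)).presheaf.stalk (B.pt (m + j)))
            (stalkIdeal (SatelliteExitClasses.strictIter B m H j) (B.pt (m + j))) →
        IsRegularLocalRing ((B.St (m + j)).presheaf.stalk (B.pt (m + j)) ⧸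
          stalkIdeal (SatelliteExitClasses.strictIter B m H j) (B.pt (m + j)))) := by
  haveI := isLocallyNoetherian_St B (m + j)
  haveI := isLocallyNoetherian_St B (m + j + 1)
  have hf := module_finite_integralClosure_branch_stalk_quotient B (m + j) (B.pt (m + j)) _ hd
  -- the stage-`(j+1)` followed stalk is the strict-transform stalk (structural recursion of `strictIter`)
  have hx1 : B.pt (m + (j + 1)) ∈ ((strictTransformIdeal (B.π (m + j)) (B.centre (m + j))
      (SatelliteExitClasses.strictIter B m H j)).support : Set (B.St (m + j + 1))) := hH (j + 1)
  have hcl := B.isClosed_pt (m + j)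
  have hkind := B.kind (m + j)
  have hy : (B.π (m + j)).base (B.pt (m + (j + 1))) = B.pt (m + j) := B.pt_map (m + j)
  -- move the stage-`j` data to the image point `π (pt (m+j+1))`
  generalize hx : B.pt (m + j) = x at hP hd hf hcl hkind hy ⊢
  subst hy
  have hne := ne_maximalIdeal_of_ringKrullDim_quotient_eq_one hd
  rcases hkind with hpt | hfor
  · -- POINT ROUND: (E1) + the g37 engine
    have hZ : B.centre (m + j) = vanishingIdeal ⟨{(B.π (m + j)).base (B.pt (m + (j + 1)))}, hcl⟩ := by
      rw [eq_vanishingIdeal_support_of_isRegular (B.centre (m + j)) (B.centre_regular (m + j))]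
      congr 1
      exact TopologicalSpace.Closeds.ext hpt
    have hZst : stalkIdeal (B.centre (m + j)) ((B.π (m + j)).base (B.pt (m + (j + 1)))) = maximalIdeal _ := by
      rw [hZ]; exact stalkIdeal_vanishingIdeal_singleton hcl
    obtain ⟨hQ, hcomap⟩ := isPrime_stalkIdeal_strictTransformIdeal_point (B.π (m + j)) (B.centre (m + j))
      (SatelliteExitClasses.strictIter B m H j) (B.isBlowup (m + j)) (B.pt (m + (j + 1))) hZst hx1
    have hσ : IsBlowup (B.π (m + j)) (vanishingIdeal ⟨{(B.π (m + j)).base (B.pt (m + (j + 1)))}, hcl⟩) :=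
      hZ ▸ B.isBlowup (m + j)
    haveI := hQ
    obtain ⟨h1, -, h3, h4⟩ := curveChain_stage_step (B.π (m + j)) (B.pt (m + (j + 1))) (B.pt (m + (j + 1))) rfl
      hcl hσ (stalkIdeal (SatelliteExitClasses.strictIter B m H j) ((B.π (m + j)).base (B.pt (m + (j + 1))))) hne
      hd hf (stalkIdeal (strictTransformIdeal (B.π (m + j)) (B.centre (m + j))
        (SatelliteExitClasses.strictIter B m H j)) (B.pt (m + (j + 1)))) (by rw [stalkMapCongr_self]; exact hcomap)
    exact ⟨hQ, h1, h3, fun _ => h4⟩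
  · -- FOREIGN ROUND: (E2), transport along `𝒪/𝔮 ≃+* 𝒪'/𝔮'`
    obtain ⟨hQ, -, ⟨e⟩⟩ := isPrime_stalkIdeal_strictTransformIdeal_foreign (B.π (m + j)) (B.centre (m + j))
      (SatelliteExitClasses.strictIter B m H j) (B.isBlowup (m + j)) (B.pt (m + (j + 1))) hfor
    haveI := hQ
    haveI : (stalkIdeal (SatelliteExitClasses.strictIter B m H (j + 1)) (B.pt (m + (j + 1)))).IsPrime := hQ
    refine ⟨hQ, ?_, ?_, fun hpt => absurd ?_ hfor⟩
    · exact (ringKrullDim_eq_of_ringEquiv e).symm.trans hd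
    · show branchDelta ((B.St (m + j + 1)).presheaf.stalk (B.pt (m + (j + 1))))
          (stalkIdeal (strictTransformIdeal (B.π (m + j)) (B.centre (m + j))
            (SatelliteExitClasses.strictIter B m H j)) (B.pt (m + (j + 1)))) ≤ _
      rw [branchDelta_eq, branchDelta_eq]
      exact le_of_eq (curveDelta_eq_of_ringEquiv e (FractionRing _) (FractionRing _)).symm
    · rw [hpt]; exact Set.mem_singleton _

/-- **`Inv j` for every `j`** (induction from `Inv 0` = F's hypotheses). [cite: Kollar2007, §1.4, Thm. 1.101] -/
theorem strictIter_inv_all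
    (hH : ∀ j, B.pt (m + j) ∈ ((SatelliteExitClasses.strictIter B m H j).support : Set (B.St (m + j))))
    (hP0 : (stalkIdeal H (B.pt m)).IsPrime)
    (hd0 : ringKrullDim ((B.St m).presheaf.stalk (B.pt m) ⧸ stalkIdeal H (B.pt m)) = 1) (j : ℕ) :
    (stalkIdeal (SatelliteExitClasses.strictIter B m H j) (B.pt (m + j))).IsPrime ∧
      ringKrullDim ((B.St (m + j)).presheaf.stalk (B.pt (m + j)) ⧸
        stalkIdeal (SatelliteExitClasses.strictIter B m H j) (B.pt (m + j))) = 1 := by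
  induction j with
  | zero => exact ⟨hP0, hd0⟩
  | succ j ih =>
    haveI := ih.1
    obtain ⟨h1, h2, -, -⟩ := strictIter_inv_succ B m H hH j ih.2
    exact ⟨h1, h2⟩

/-- **δ is finite along the branch** (`dim = 1` + finite normalisation). [cite: Kollar2007, §1.4, Thm. 1.101] -/
theorem strictIter_delta_ne_top
    (hH : ∀ j, B.pt (m + j) ∈ ((SatelliteExitClasses.strictIter B m H j).support : Set (B.St (m + j))))
    (hP0 : (stalkIdeal H (B.pt m)).IsPrime)
    (hd0 : ringKrullDim ((B.St m).presheaf.stalk (B.pt m) ⧸ stalkIdeal H (B.pt m)) = 1) (j : ℕ) :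
    branchDelta ((B.St (m + j)).presheaf.stalk (B.pt (m + j)))
      (stalkIdeal (SatelliteExitClasses.strictIter B m H j) (B.pt (m + j))) ≠ ⊤ := by
  haveI := isLocallyNoetherian_St B (m + j)
  obtain ⟨hP, hd⟩ := strictIter_inv_all B m H hH hP0 hd0 j
  haveI := hP
  haveI : IsLocalRing ((B.St (m + j)).presheaf.stalk (B.pt (m + j)) ⧸
      stalkIdeal (SatelliteExitClasses.strictIter B m H j) (B.pt (m + j))) :=
    IsLocalRing.of_surjective' (Ideal.Quotient.mk _) Ideal.Quotient.mk_surjective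
  haveI := module_finite_integralClosure_branch_stalk_quotient B (m + j) (B.pt (m + j)) _ hd
  rw [branchDelta_eq]
  exact curveDelta_ne_top (FractionRing _) hd

/-- **δ is antitone along the branch**: `δ_{j+i} ≤ δ_j`. [cite: Kollar2007, §1.4, Thm. 1.101] -/
theorem strictIter_delta_le
    (hH : ∀ j, B.pt (m + j) ∈ ((SatelliteExitClasses.strictIter B m H j).support : Set (B.St (m + j))))
    (hP0 : (stalkIdeal H (B.pt m)).IsPrime)
    (hd0 : ringKrullDim ((B.St m).presheaf.stalk (B.pt m) ⧸ stalkIdeal H (B.pt m)) = 1) (j i : ℕ) :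
    branchDelta ((B.St (m + (j + i))).presheaf.stalk (B.pt (m + (j + i))))
        (stalkIdeal (SatelliteExitClasses.strictIter B m H (j + i)) (B.pt (m + (j + i)))) ≤
      branchDelta ((B.St (m + j)).presheaf.stalk (B.pt (m + j)))
        (stalkIdeal (SatelliteExitClasses.strictIter B m H j) (B.pt (m + j))) := by
  induction i with
  | zero => exact le_rfl
  | succ i ih =>
    haveI := (strictIter_inv_all B m H hH hP0 hd0 (j + i)).1
    exact (strictIter_inv_succ B m H hH (j + i) (strictIter_inv_all B m H hH hP0 hd0 (j + i)).2).2.2.1.trans ih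

/-- **the point rounds are cofinal** along the branch, in relative indexing (`Branch.io`). [folklore] -/
theorem exists_point_round (j : ℕ) :
    ∃ i, ((B.centre (m + (j + i))).support : Set (B.St (m + (j + i)))) = {B.pt (m + (j + i))} := by
  obtain ⟨i₀, hi₀, hpt⟩ := B.io (m + j)
  obtain ⟨i, rfl⟩ : ∃ i, i₀ = m + (j + i) := ⟨i₀ - (m + j), by omega⟩
  exact ⟨i, hpt⟩

/-- **at a point round, the followed germ is regular or δ drops.** [cite: Kollar2007, §1.4, Thm. 1.101] -/
theorem regular_or_delta_lt
    (hH : ∀ j, B.pt (m + j) ∈ ((SatelliteExitClasses.strictIter B m H j).support : Set (B.St (m + j))))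
    (hP0 : (stalkIdeal H (B.pt m)).IsPrime)
    (hd0 : ringKrullDim ((B.St m).presheaf.stalk (B.pt m) ⧸ stalkIdeal H (B.pt m)) = 1) (j : ℕ)
    (hpt : ((B.centre (m + j)).support : Set (B.St (m + j))) = {B.pt (m + j)}) :
    (IsRegularLocalRing ((B.St (m + j)).presheaf.stalk (B.pt (m + j)) ⧸
        stalkIdeal (SatelliteExitClasses.strictIter B m H j) (B.pt (m + j))) ∧
      ringKrullDim ((B.St (m + j)).presheaf.stalk (B.pt (m + j)) ⧸
        stalkIdeal (SatelliteExitClasses.strictIter B m H j) (B.pt (m + j))) = 1) ∨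
      branchDelta ((B.St (m + (j + 1))).presheaf.stalk (B.pt (m + (j + 1))))
          (stalkIdeal (SatelliteExitClasses.strictIter B m H (j + 1)) (B.pt (m + (j + 1)))) <
        branchDelta ((B.St (m + j)).presheaf.stalk (B.pt (m + j)))
          (stalkIdeal (SatelliteExitClasses.strictIter B m H j) (B.pt (m + j))) := by
  obtain ⟨hP, hd⟩ := strictIter_inv_all B m H hH hP0 hd0 j
  haveI := hP
  obtain ⟨-, -, hle, hreg⟩ := strictIter_inv_succ B m H hH j hd
  rcases hle.eq_or_lt with heq | hlt
  · exact Or.inl ⟨hreg hpt heq, hd⟩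
  · exact Or.inr hlt

/-- **THE DESCENT**: some followed germ of the branch is regular (and one-dimensional).  By induction on a bound
`d ≥ δ_j`: jump to the next point round `j + i` (`exists_point_round`; `δ_{j+i} ≤ δ_j ≤ d`); there the germ is regular or
`δ_{j+i+1} < δ_{j+i} ≤ d`, and the induction hypothesis applies to `j + i + 1`.  [cite: Kollar2007, §1.4, Thm. 1.101] -/
theorem exists_regular_strictIter
    (hH : ∀ j, B.pt (m + j) ∈ ((SatelliteExitClasses.strictIter B m H j).support : Set (B.St (m + j))))
    (hP0 : (stalkIdeal H (B.pt m)).IsPrime)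
    (hd0 : ringKrullDim ((B.St m).presheaf.stalk (B.pt m) ⧸ stalkIdeal H (B.pt m)) = 1) :
    ∃ j : ℕ, IsRegularLocalRing ((B.St (m + j)).presheaf.stalk (B.pt (m + j)) ⧸
        stalkIdeal (SatelliteExitClasses.strictIter B m H j) (B.pt (m + j))) ∧
      ringKrullDim ((B.St (m + j)).presheaf.stalk (B.pt (m + j)) ⧸
        stalkIdeal (SatelliteExitClasses.strictIter B m H j) (B.pt (m + j))) = 1 := by
  suffices h : ∀ d : ℕ, ∀ j : ℕ,
      branchDelta ((B.St (m + j)).presheaf.stalk (B.pt (m + j)))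
        (stalkIdeal (SatelliteExitClasses.strictIter B m H j) (B.pt (m + j))) ≤ d →
      ∃ j : ℕ, IsRegularLocalRing ((B.St (m + j)).presheaf.stalk (B.pt (m + j)) ⧸
          stalkIdeal (SatelliteExitClasses.strictIter B m H j) (B.pt (m + j))) ∧
        ringKrullDim ((B.St (m + j)).presheaf.stalk (B.pt (m + j)) ⧸
          stalkIdeal (SatelliteExitClasses.strictIter B m H j) (B.pt (m + j))) = 1 by
    obtain ⟨d, hd⟩ := ENat.ne_top_iff_exists.mp (strictIter_delta_ne_top B m H hH hP0 hd0 0)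
    exact h d 0 hd.symm.le
  intro d
  induction d with
  | zero =>
    intro j hj
    obtain ⟨i, hpt⟩ := exists_point_round B m j
    rcases regular_or_delta_lt B m H hH hP0 hd0 (j + i) hpt with h | hlt
    · exact ⟨j + i, h⟩
    · exfalso
      have hj0 : branchDelta ((B.St (m + j)).presheaf.stalk (B.pt (m + j)))
          (stalkIdeal (SatelliteExitClasses.strictIter B m H j) (B.pt (m + j))) = 0 := by simpa using hj
      have h0 := nonpos_iff_eq_zero.mp ((strictIter_delta_le B m H hH hP0 hd0 j i).trans hj0.le)
      rw [h0] at hlt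
      exact not_lt_zero hlt
  | succ d ih =>
    intro j hj
    obtain ⟨i, hpt⟩ := exists_point_round B m j
    rcases regular_or_delta_lt B m H hH hP0 hd0 (j + i) hpt with h | hlt
    · exact ⟨j + i, h⟩
    · refine ih (j + i + 1) ?_
      have h1 := (strictIter_delta_le B m H hH hP0 hd0 j i).trans hj
      rw [Nat.cast_succ] at h1
      exact (ENat.lt_add_one_iff (ENat.coe_ne_top d)).mp (lt_of_lt_of_le hlt h1)

end BranchLoop

/-! ## §165 (g45 · THE DISCHARGE) `HuggedBranchResolution` is a THEOREM — zero binders; hence item 32207. -/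

/-- **F = `HuggedBranchResolution` (the located residual of the g44 root) HOLDS**: along a hugged PRIME one-dimensional
germ of any branch over any field, some followed germ is regular (δ-descent along the branch, `exists_regular_strictIter`).
Uses no hypothesis on the field (no perfectness / characteristic / algebraic closure); `Branch` carries exactly lens-6's
fields (`IsBase`: separated, locally of finite type, quasi-compact, regular, `dim ≤ 4`). [cite: Kollar2007, §1.4, Thm. 1.101] -/
theorem huggedBranchResolution_holds : HuggedBranchResolution := by
  intro k _ B m H hH hP hd
  obtain ⟨-, hhug⟩ := hH
  haveI := hP
  exact exists_regular_strictIter B m H hhug hP hd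

/-- **ITEM 32207 — `MaxContactCut.CurveLawAll` HOLDS** (the g44 port `curveLawAll_of_huggedBranchResolution` applied to
the theorem `huggedBranchResolution_holds`; zero binders). [cite: Kollar2007, §1.4, Thm. 1.101] -/
theorem curveLawAll_holds :
    Summit.ResolutionOfSingularities.ResolutionOfSingularities.Theses.MaxContactCut.CurveLawAll :=
  curveLawAll_of_huggedBranchResolution huggedBranchResolution_holds

end Summit.ResolutionOfSingularities.ResolutionOfSingularities.Theorems.HugValuationCut
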